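import Literature.NumberTheory.EllipticCurves.KugaSatoVarietySLAction
import HarnessLib

/-!
# The action of `GL₂(ℤ/N)` on the fine moduli scheme `Y(N)` (Deligne (3.7))

Topic: `Literature/NumberTheory/EllipticCurves`. For the fine moduli scheme
`M = (Y, E, φ) : FullLevelModularCurve K N` of `KugaSatoVariety.lean` (Deligne (3.6)–(3.7),
Katz–Mazur Cor. 4.7.2) this file CONSTRUCTS, from the universal property `classify` alone, the
action of `GL₂(ℤ/N)` on `Y(N)_K` printed in Deligne (3.7): "le groupe `GL₂(ℤ/n)` agit sur `M_n`
par `α ↦ α ∘ g`" (Deninger–Scholl (4.10)) — the `K`-automorphism of `Y` classifying the twisted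
universal pair `(E, φ ∘ γ)` (`LevelStructure.twistGL` of `KugaSatoLevelTwist.lean`) — and proves
that it is a (right) action by isomorphisms. The structure `KugaSatoVariety`/`KugaSatoBase` only
POSTULATES such data on a component (fields `slY`, `slY_classifies`); here they are derived for the
full moduli scheme, which is the first step of the printed construction of that component action
(the second, non-formal, step being that elements of determinant `1` stabilise each component,
via the Weil pairing).

* `FullLevelModularCurve.classifyingMap M S C ψ` — THE classifying `K`-morphism `S → Y` of a pair
  `(C, ψ)` (choice from `classify`), with `classifyingMap_spec`, `eq_classifyingMap`,
  `hom_ext_of_isBaseChangeVia` (two morphisms classifying the same pair agree) and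
  `classifyingMap_self = 𝟙`.
* `FullLevelModularCurve.glAct M hc γ : Y ⟶ Y` for `γ ∈ GL₂(ℤ/N) = (M₂(ℤ/N))ˣ` — the classifying
  map of `(E, φ ∘ γ)`; `glAct_classifies`, `eq_glAct`; **action laws** `glAct_one`,
  `glAct_mul : glAct (γ δ) = glAct γ ≫ glAct δ` (a right action written diagrammatically, as
  `(φ ∘ γ) ∘ δ = φ ∘ (γ δ)`), `glAct_inv_comp`, `glAct_comp_inv`, `isIso_glAct`, and the
  automorphism `glActIso`.
* `FullLevelModularCurve.slAct M hc g` for `g ∈ SL₂(ℤ/N)` — the same with `LevelStructure.twist`,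
  `slAct_one`, `slAct_mul`, `isIso_slAct`, and `slAct_classifies'` — the data in the exact shape of
  the field `KugaSatoBase.slY_classifies` (a base change `G : E → E` of group schemes over
  `slAct g` carrying `(P^{g₀₀} Q^{g₁₀}, P^{g₀₁} Q^{g₁₁})` to `(P, Q)`).

As in `KugaSatoLevelTwist.lean`, twisting requires the universal sections `P, Q` to commute
(`hc : Commute φ.P φ.Q`; automatic for an elliptic curve, Katz–Mazur Thm. 2.1.2, but not recorded
by `EllCurveOver`). No named facts.

## References

* P. Deligne, *Formes modulaires et représentations ℓ-adiques*, Sém. Bourbaki 355 (1969), (3.7).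
  [Deligne1971Bourbaki355]
* C. Deninger, A. J. Scholl, *The Beilinson conjectures*, in *L-functions and Arithmetic*
  (Durham 1989), LMS LNS 153, CUP 1991, §4.1, (4.10). [DeningerScholl1991]
* N. Katz, B. Mazur, *Arithmetic moduli of elliptic curves* (1985), (3.1), Cor. 4.7.2.
  [KatzMazur1985]
-/

universe u

open CategoryTheory Limits AlgebraicGeometry MonoidalCategory CartesianMonoidalCategory
open scoped MonObj MatrixGroups

noncomputable section

namespace Literature.NumberTheory.EllipticCurves

/-! ### Columns of a product, `GL₂` version -/

namespace EllCurveOver.LevelStructure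

variable {S : Scheme.{u}} {C : EllCurveOver S} {N : ℕ} (φ : LevelStructure N C)

/-- The columns of a product in `GL₂(ℤ/N)`: the first section of `φ ∘ (γ δ)` is the
`(δ₀₀, δ₁₀)`-section of `φ ∘ γ`. [folklore] -/
theorem twistGL_section_col_zero [NeZero N] (hc : Commute φ.P φ.Q)
    (γ δ : (Matrix (Fin 2) (Fin 2) (ZMod N))ˣ) :
    (φ.twistGL hc γ).section_ (δ.1 0 0, δ.1 1 0) = (φ.twistGL hc (γ * δ)).P := by
  rw [twistGL_section_, twistGL_P, vecAct_apply, Units.val_mul, Matrix.mul_apply,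
    Matrix.mul_apply, Fin.sum_univ_two, Fin.sum_univ_two]

/-- The columns of a product in `GL₂(ℤ/N)`: the second section of `φ ∘ (γ δ)` is the
`(δ₀₁, δ₁₁)`-section of `φ ∘ γ`. [folklore] -/
theorem twistGL_section_col_one [NeZero N] (hc : Commute φ.P φ.Q)
    (γ δ : (Matrix (Fin 2) (Fin 2) (ZMod N))ˣ) :
    (φ.twistGL hc γ).section_ (δ.1 0 1, δ.1 1 1) = (φ.twistGL hc (γ * δ)).Q := by
  rw [twistGL_section_, twistGL_Q, vecAct_apply, Units.val_mul, Matrix.mul_apply,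
    Matrix.mul_apply, Fin.sum_univ_two, Fin.sum_univ_two]

/-- Twisting by `1 ∈ GL₂(ℤ/N)` does nothing to `P`. [folklore] -/
theorem twistGL_one_P [NeZero N] (hc : Commute φ.P φ.Q) : (φ.twistGL hc 1).P = φ.P := by
  rw [twistGL_P, Units.val_one, Matrix.one_apply_eq, Matrix.one_apply_ne (by decide),
    section_one_zero]

/-- Twisting by `1 ∈ GL₂(ℤ/N)` does nothing to `Q`. [folklore] -/
theorem twistGL_one_Q [NeZero N] (hc : Commute φ.P φ.Q) : (φ.twistGL hc 1).Q = φ.Q := by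
  rw [twistGL_Q, Units.val_one, Matrix.one_apply_eq, Matrix.one_apply_ne (by decide),
    section_zero_one]

end EllCurveOver.LevelStructure

namespace FullLevelModularCurve

open Literature.AlgebraicGeometry.Motives EllCurveOver

variable {K : Type u} [Field K] {N : ℕ} (M : FullLevelModularCurve K N)

/-! ### The classifying morphism -/

/-- **The classifying morphism** of a pair `(C, ψ)` (elliptic curve with full level-`N`
structure) over a `K`-scheme `S`: the unique `K`-morphism `S → Y(N)_K` along which `(C, ψ)` is a
base change of the universal pair (Deligne (3.6)–(3.7); Katz–Mazur Cor. 4.7.2), chosen from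
`FullLevelModularCurve.classify`. [cite: KatzMazur1985, Cor. 4.7.2] -/
def classifyingMap (S : SchemeOver K) (C : EllCurveOver S.left) (ψ : C.LevelStructure N) :
    S ⟶ M.Y :=
  (M.classify S C ψ).exists.choose

/-- Along the classifying morphism, `(C, ψ)` is a base change of the universal pair. [folklore] -/
theorem classifyingMap_spec (S : SchemeOver K) (C : EllCurveOver S.left)
    (ψ : C.LevelStructure N) :
    ∃ G : C.E.left ⟶ M.curve.E.left, ψ.IsBaseChangeVia M.level (M.classifyingMap S C ψ).left G :=
  (M.classify S C ψ).exists.choose_spec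

/-- **Fine moduli**: two `K`-morphisms `S → Y(N)_K` along both of which `(C, ψ)` is a base change
of the universal pair are equal. [cite: KatzMazur1985, Cor. 4.7.2] -/
theorem hom_ext_of_isBaseChangeVia {S : SchemeOver K} {C : EllCurveOver S.left}
    (ψ : C.LevelStructure N) {g₁ g₂ : S ⟶ M.Y} {G₁ G₂ : C.E.left ⟶ M.curve.E.left}
    (h₁ : ψ.IsBaseChangeVia M.level g₁.left G₁) (h₂ : ψ.IsBaseChangeVia M.level g₂.left G₂) :
    g₁ = g₂ :=
  (M.classify S C ψ).unique ⟨G₁, h₁⟩ ⟨G₂, h₂⟩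

/-- Any morphism classifying `(C, ψ)` is THE classifying morphism. [folklore] -/
theorem eq_classifyingMap {S : SchemeOver K} {C : EllCurveOver S.left} (ψ : C.LevelStructure N)
    {g : S ⟶ M.Y} {G : C.E.left ⟶ M.curve.E.left} (h : ψ.IsBaseChangeVia M.level g.left G) :
    g = M.classifyingMap S C ψ := by
  obtain ⟨G', h'⟩ := M.classifyingMap_spec S C ψ
  exact M.hom_ext_of_isBaseChangeVia ψ h h'

/-- The universal pair is classified by the identity. [folklore] -/
theorem classifyingMap_self : M.classifyingMap M.Y M.curve M.level = 𝟙 M.Y :=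
  (M.eq_classifyingMap M.level (g := 𝟙 M.Y) (LevelStructure.IsBaseChangeVia.refl M.level)).symm

/-! ### The action of `GL₂(ℤ/N)` -/

section GeneralLinear

variable [NeZero N] (hc : Commute M.level.P M.level.Q)

/-- **Deligne's action of `γ ∈ GL₂(ℤ/N)` on `Y(N)_K`** ("le groupe `GL₂(ℤ/n)` agit sur `M_n` par
`α ↦ α ∘ g`", Deligne (3.7); Deninger–Scholl (4.10)): the `K`-endomorphism of `Y` classifying the
twisted universal pair `(E, φ ∘ γ) = (E, (P^{γ₀₀} Q^{γ₁₀}, P^{γ₀₁} Q^{γ₁₁}))`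
(`LevelStructure.twistGL`). Requires the universal sections `P, Q` to commute.
[cite: Deligne1971Bourbaki355, (3.7)] -/
def glAct (γ : (Matrix (Fin 2) (Fin 2) (ZMod N))ˣ) : M.Y ⟶ M.Y :=
  M.classifyingMap M.Y M.curve (M.level.twistGL hc γ)

/-- `glAct γ` classifies `(E, φ ∘ γ)`: along it (and some `G : E → E`) the pair `(E, φ ∘ γ)` is a
base change of `(E, φ)`. [cite: Deligne1971Bourbaki355, (3.7)] -/
theorem glAct_classifies (γ : (Matrix (Fin 2) (Fin 2) (ZMod N))ˣ) :
    ∃ G : M.curve.E.left ⟶ M.curve.E.left,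
      (M.level.twistGL hc γ).IsBaseChangeVia M.level (M.glAct hc γ).left G :=
  M.classifyingMap_spec M.Y M.curve _

/-- Any `K`-endomorphism of `Y` classifying `(E, φ ∘ γ)` is `glAct γ`. [folklore] -/
theorem eq_glAct (γ : (Matrix (Fin 2) (Fin 2) (ZMod N))ˣ) {f : M.Y ⟶ M.Y}
    {G : M.curve.E.left ⟶ M.curve.E.left}
    (h : (M.level.twistGL hc γ).IsBaseChangeVia M.level f.left G) : f = M.glAct hc γ :=
  M.eq_classifyingMap _ h

/-- **`glAct 1 = 𝟙`**: the identity classifies `(E, φ ∘ 1) = (E, φ)`.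
[cite: Deligne1971Bourbaki355, (3.7)] -/
theorem glAct_one : M.glAct hc 1 = 𝟙 M.Y := by
  refine (M.eq_glAct hc 1 (f := 𝟙 M.Y) (G := 𝟙 _) ?_).symm
  refine ⟨EllCurveOver.IsBaseChangeVia.refl M.curve, ?_, ?_⟩
  · rw [M.level.twistGL_one_P hc]
    exact (LevelStructure.IsBaseChangeVia.refl M.level).2.1
  · rw [M.level.twistGL_one_Q hc]
    exact (LevelStructure.IsBaseChangeVia.refl M.level).2.2

-- `(𝟙_ (Over Y)).left = Y` by unfolding (types of the sections).
set_option backward.isDefEq.respectTransparency false in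
/-- **`γ ↦ glAct γ` is a right action**: `glAct (γ δ) = glAct γ ≫ glAct δ`. Along
`glAct γ ≫ glAct δ` the pair `(E, φ ∘ (γ δ))` is a base change of `(E, φ)`: pull `(P, Q)` back
along `glAct δ` to `φ ∘ δ`, then along `glAct γ`; a base change is a homomorphism on sections
(`LevelStructure.IsBaseChangeVia.section_left_comp`), so the columns of `φ ∘ δ` pull back to the
corresponding sections of `φ ∘ γ`, which are the columns of `φ ∘ (γ δ)`
(`twistGL_section_col_zero/one`); conclude by uniqueness (`eq_glAct`). This is "`α ↦ α ∘ g`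
is an action of `GL₂(ℤ/n)` on `M_n`" (Deligne (3.7)). [cite: Deligne1971Bourbaki355, (3.7)] -/
theorem glAct_mul (γ δ : (Matrix (Fin 2) (Fin 2) (ZMod N))ˣ) :
    M.glAct hc (γ * δ) = M.glAct hc γ ≫ M.glAct hc δ := by
  obtain ⟨Gγ, hγ⟩ := M.glAct_classifies hc γ
  obtain ⟨Gδ, hδ⟩ := M.glAct_classifies hc δ
  refine (M.eq_glAct hc (γ * δ) (f := M.glAct hc γ ≫ M.glAct hc δ) (G := Gγ ≫ Gδ) ?_).symm
  rw [Over.comp_left]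
  refine ⟨hδ.1.comp hγ.1, ?_, ?_⟩
  · rw [← M.level.twistGL_section_col_zero hc γ δ, ← Category.assoc,
      hγ.section_left_comp (δ.1 0 0, δ.1 1 0), Category.assoc, ← M.level.twistGL_P hc δ, hδ.2.1,
      Category.assoc]
  · rw [← M.level.twistGL_section_col_one hc γ δ, ← Category.assoc,
      hγ.section_left_comp (δ.1 0 1, δ.1 1 1), Category.assoc, ← M.level.twistGL_Q hc δ, hδ.2.2,
      Category.assoc]

/-- `glAct γ⁻¹ ≫ glAct γ = 𝟙`. [folklore] -/
theorem glAct_inv_comp (γ : (Matrix (Fin 2) (Fin 2) (ZMod N))ˣ) :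
    M.glAct hc γ⁻¹ ≫ M.glAct hc γ = 𝟙 M.Y := by
  rw [← M.glAct_mul hc, inv_mul_cancel, M.glAct_one]

/-- `glAct γ ≫ glAct γ⁻¹ = 𝟙`. [folklore] -/
theorem glAct_comp_inv (γ : (Matrix (Fin 2) (Fin 2) (ZMod N))ˣ) :
    M.glAct hc γ ≫ M.glAct hc γ⁻¹ = 𝟙 M.Y := by
  rw [← M.glAct_mul hc, mul_inv_cancel, M.glAct_one]

/-- Each `glAct γ` is an automorphism of the `K`-scheme `Y(N)_K`. [folklore] -/
theorem isIso_glAct (γ : (Matrix (Fin 2) (Fin 2) (ZMod N))ˣ) : IsIso (M.glAct hc γ) :=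
  ⟨M.glAct hc γ⁻¹, M.glAct_comp_inv hc γ, M.glAct_inv_comp hc γ⟩

/-- **The automorphism `α ↦ α ∘ γ` of `Y(N)_K`** as an isomorphism of `K`-schemes, with inverse
`glAct γ⁻¹` (Deligne (3.7)). [cite: Deligne1971Bourbaki355, (3.7)] -/
def glActIso (γ : (Matrix (Fin 2) (Fin 2) (ZMod N))ˣ) : M.Y ≅ M.Y where
  hom := M.glAct hc γ
  inv := M.glAct hc γ⁻¹
  hom_inv_id := M.glAct_comp_inv hc γ
  inv_hom_id := M.glAct_inv_comp hc γ

/-- Unfolding of `glActIso`. [folklore] -/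
@[simp]
theorem glActIso_hom (γ : (Matrix (Fin 2) (Fin 2) (ZMod N))ˣ) :
    (M.glActIso hc γ).hom = M.glAct hc γ := rfl

/-- Unfolding of `glActIso`. [folklore] -/
@[simp]
theorem glActIso_inv (γ : (Matrix (Fin 2) (Fin 2) (ZMod N))ˣ) :
    (M.glActIso hc γ).inv = M.glAct hc γ⁻¹ := rfl

/-- `glActIso` turns products into compositions: `glActIso (γ δ) = glActIso γ ≪≫ glActIso δ`.
[folklore] -/
theorem glActIso_mul (γ δ : (Matrix (Fin 2) (Fin 2) (ZMod N))ˣ) :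
    M.glActIso hc (γ * δ) = M.glActIso hc γ ≪≫ M.glActIso hc δ :=
  Iso.ext (M.glAct_mul hc γ δ)

/-- `glActIso 1` is the identity. [folklore] -/
theorem glActIso_one : M.glActIso hc 1 = Iso.refl M.Y :=
  Iso.ext (M.glAct_one hc)

end GeneralLinear

/-! ### The action of `SL₂(ℤ/N)` -/

section SpecialLinear

variable [NeZero N] (hc : Commute M.level.P M.level.Q)

/-- **The action of `g ∈ SL₂(ℤ/N)` on `Y(N)_K`**: the `K`-endomorphism classifying
`(E, φ ∘ g)` (`LevelStructure.twist`; Deligne (3.7), restricted to `SL₂`, the subgroup that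
stabilises the components over `K ∋ ζ_N`, Deninger–Scholl §4.1).
[cite: Deligne1971Bourbaki355, (3.7)] -/
def slAct (g : SL(2, ZMod N)) : M.Y ⟶ M.Y :=
  M.classifyingMap M.Y M.curve (M.level.twist hc g)

/-- `slAct g` classifies `(E, φ ∘ g)`. [cite: Deligne1971Bourbaki355, (3.7)] -/
theorem slAct_classifies (g : SL(2, ZMod N)) :
    ∃ G : M.curve.E.left ⟶ M.curve.E.left,
      (M.level.twist hc g).IsBaseChangeVia M.level (M.slAct hc g).left G :=
  M.classifyingMap_spec M.Y M.curve _

/-- Any `K`-endomorphism of `Y` classifying `(E, φ ∘ g)` is `slAct g`. [folklore] -/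
theorem eq_slAct (g : SL(2, ZMod N)) {f : M.Y ⟶ M.Y} {G : M.curve.E.left ⟶ M.curve.E.left}
    (h : (M.level.twist hc g).IsBaseChangeVia M.level f.left G) : f = M.slAct hc g :=
  M.eq_classifyingMap _ h

/-- **`slAct g` in the shape of `KugaSatoBase.slY_classifies`**: there is a base change
`G : E → E` of group schemes over `slAct g` carrying `(P^{g₀₀} Q^{g₁₀}, P^{g₀₁} Q^{g₁₁})` to
`(P, Q)`. [cite: Deligne1971Bourbaki355, (3.7)] -/
theorem slAct_classifies' (g : SL(2, ZMod N)) :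
    ∃ G : M.curve.E.left ⟶ M.curve.E.left,
      M.curve.IsBaseChangeVia M.curve (M.slAct hc g).left G ∧
        (M.level.section_ (g.1 0 0, g.1 1 0)).left ≫ G = (M.slAct hc g).left ≫ M.level.P.left ∧
        (M.level.section_ (g.1 0 1, g.1 1 1)).left ≫ G = (M.slAct hc g).left ≫ M.level.Q.left := by
  obtain ⟨G, hG, hP, hQ⟩ := M.slAct_classifies hc g
  exact ⟨G, hG, hP, hQ⟩

/-- **`slAct 1 = 𝟙`**. [cite: Deligne1971Bourbaki355, (3.7)] -/
theorem slAct_one : M.slAct hc 1 = 𝟙 M.Y := by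
  refine (M.eq_slAct hc 1 (f := 𝟙 M.Y) (G := 𝟙 _) ?_).symm
  refine ⟨EllCurveOver.IsBaseChangeVia.refl M.curve, ?_, ?_⟩
  · rw [M.level.twist_one_P hc]
    exact (LevelStructure.IsBaseChangeVia.refl M.level).2.1
  · rw [M.level.twist_one_Q hc]
    exact (LevelStructure.IsBaseChangeVia.refl M.level).2.2

-- `(𝟙_ (Over Y)).left = Y` by unfolding (types of the sections).
set_option backward.isDefEq.respectTransparency false in
/-- **`g ↦ slAct g` is a right action**: `slAct (h g) = slAct h ≫ slAct g` (as for
`KugaSatoVariety.slY_mul`, now for the constructed action on the full moduli scheme).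
[cite: Deligne1971Bourbaki355, (3.7)] -/
theorem slAct_mul (h g : SL(2, ZMod N)) : M.slAct hc (h * g) = M.slAct hc h ≫ M.slAct hc g := by
  obtain ⟨Gh, hh⟩ := M.slAct_classifies hc h
  obtain ⟨Gg, hg⟩ := M.slAct_classifies hc g
  refine (M.eq_slAct hc (h * g) (f := M.slAct hc h ≫ M.slAct hc g) (G := Gh ≫ Gg) ?_).symm
  rw [Over.comp_left]
  refine ⟨hg.1.comp hh.1, ?_, ?_⟩
  · rw [← M.level.twist_section_col_zero hc h g, ← Category.assoc,
      hh.section_left_comp (g.1 0 0, g.1 1 0), Category.assoc, ← M.level.twist_P hc g, hg.2.1,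
      Category.assoc]
  · rw [← M.level.twist_section_col_one hc h g, ← Category.assoc,
      hh.section_left_comp (g.1 0 1, g.1 1 1), Category.assoc, ← M.level.twist_Q hc g, hg.2.2,
      Category.assoc]

/-- `slAct g⁻¹ ≫ slAct g = 𝟙`. [folklore] -/
theorem slAct_inv_comp (g : SL(2, ZMod N)) : M.slAct hc g⁻¹ ≫ M.slAct hc g = 𝟙 M.Y := by
  rw [← M.slAct_mul hc, inv_mul_cancel, M.slAct_one]

/-- `slAct g ≫ slAct g⁻¹ = 𝟙`. [folklore] -/
theorem slAct_comp_inv (g : SL(2, ZMod N)) : M.slAct hc g ≫ M.slAct hc g⁻¹ = 𝟙 M.Y := by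
  rw [← M.slAct_mul hc, mul_inv_cancel, M.slAct_one]

/-- Each `slAct g` is an automorphism of the `K`-scheme `Y(N)_K`. [folklore] -/
theorem isIso_slAct (g : SL(2, ZMod N)) : IsIso (M.slAct hc g) :=
  ⟨M.slAct hc g⁻¹, M.slAct_comp_inv hc g, M.slAct_inv_comp hc g⟩

/-- `slAct g` is `glAct` of the same matrix regarded in `GL₂(ℤ/N)`: both classify the pair with
sections `(P^{g₀₀} Q^{g₁₀}, P^{g₀₁} Q^{g₁₁})`. [folklore] -/
theorem slAct_eq_glAct (g : SL(2, ZMod N)) (γ : (Matrix (Fin 2) (Fin 2) (ZMod N))ˣ)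
    (h : γ.1 = g.1) : M.slAct hc g = M.glAct hc γ := by
  obtain ⟨G, hG, hP, hQ⟩ := M.slAct_classifies hc g
  refine M.eq_glAct hc γ (G := G) ⟨hG, ?_, ?_⟩
  · rw [← M.level.twist_P_eq_twistGL_P hc g γ h]
    exact hP
  · rw [← M.level.twist_Q_eq_twistGL_Q hc g γ h]
    exact hQ

end SpecialLinear

end FullLevelModularCurve

end Literature.NumberTheory.EllipticCurves

end
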